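import Summits.QuantumFields.YangMills.Theorems.SwapVirialDeficitSigmaBallModel
import HarnessLib

/-!
# END-CORE LEADER-SIDE INTEGRALS, brick (S1a): the SYMMETRIC 3-letter slab `∫⁻_{(−s,s)×(−A,A)×(−B,B)} (δ²+x²+y²)⁻¹ ≤ 72·(sAB)^{1/3}`
# (stub `stub_core_end` of skeleton ➎, leader side — the Σ-slab of LEAD sfw-p2 g99's memo8 §2(c)/memo10 §2 on the FULL slab, not an octant;
# free-hands support of ⟨stmt-QuantumFields-24197⟩ `SwapVirialDeficit.SwapGluedStiffness`)

LEAD's ✓`lintegral_octant_slab_inv_sum_sq_le` bounds the positive octant; the end-core letters `(δ, x₀, y₀)` range over the full slab.  Instead of eight reflections this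
file punctures each interval at `0` (a null set: `puncturedIoo_ae_eq`, via `Measure.set_prod_ae_eq`), where the AM–GM majorant ✓`inv_sum_sq_three_le`
`(δ²+x²+y²)⁻¹ ≤ ⅓|δ|^{-2/3}|x|^{-2/3}|y|^{-2/3}` holds pointwise, and integrates the product: `lintegral_Ioo_neg_abs_rpow` (reflection of ✓`lintegral_Ioo_rpow_neg_two_thirds`
by `Measure.measurePreserving_neg`), `lintegral_Ioo_pos_abs_rpow`, `lintegral_puncturedIoo_abs_rpow_le` (`≤ 6s^{1/3}`), and
* ★★ `lintegral_symm_slab_inv_sum_sq_le (hs hA hB : 0 ≤ ·) : ∫⁻_{Ioo(−s)s ×ˢ (Ioo(−A)A ×ˢ Ioo(−B)B)} ofReal((p.1²+p.2.1²+p.2.2²)⁻¹) ≤ ofReal(72·s^{1/3}A^{1/3}B^{1/3})`.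
With the `u`-first bound ✓`lintegral_uFirst_le` (brick U1) and LEAD's `u`-free rate `B₀(δ,x₀,y₀) ≥ 2(δ²+x₀²+y₀²)` on the unit box this is the Σ-patch share `≲ s^{1/3}`.

HONEST LABEL: elementary real analysis (Mathlib + ✓SigmaBallModel); `stub_core_end`, stubs B (assembly) ∕ core-tip ∕ 001-good, ⟨24197⟩ ∕ ⟨24194⟩ and every rung OPEN;
own crux ⟨22884⟩ OPEN (blocked-on ⟨19935⟩); the Yang–Mills mass gap is NOT proved; no summit is proved by a line.  THEOREMS ONLY (0 `def`, 0 `sorry`), standard axioms.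
Width seat ym-line-sfw-p2-w3 g67 (cell ym-idea-1, free hands), `--supports stmt-QuantumFields-24197`.  References: [folklore].
-/

set_option autoImplicit false

noncomputable section

open MeasureTheory Set Real
open scoped ENNReal

namespace Summit.QuantumFields.YangMills.Theorems.SwapVirialDeficit.SigmaBall

/-- `∫⁻_{(−s,0)} |x|^{-2/3} = 3·s^{1/3}` (reflection of ✓`lintegral_Ioo_rpow_neg_two_thirds`). [folklore] -/
theorem lintegral_Ioo_neg_abs_rpow {s : ℝ} (hs : 0 ≤ s) :
    ∫⁻ x in Ioo (-s) 0, ENNReal.ofReal (|x| ^ (-(2 / 3) : ℝ)) = ENNReal.ofReal (3 * s ^ (1 / 3 : ℝ)) := by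
  have hpre : (Neg.neg : ℝ → ℝ) ⁻¹' Ioo (0:ℝ) s = Ioo (-s) 0 := by
    ext x; simp only [mem_preimage, mem_Ioo]; constructor <;> rintro ⟨h1, h2⟩ <;> constructor <;> linarith
  have h := (Measure.measurePreserving_neg (volume : Measure ℝ)).restrict_preimage (f := (Neg.neg : ℝ → ℝ)) (measurableSet_Ioo (a := (0:ℝ)) (b := s))
  rw [hpre] at h
  have e := h.lintegral_comp (f := fun y : ℝ => ENNReal.ofReal (|y| ^ (-(2 / 3) : ℝ))) (by fun_prop)
  simp only [abs_neg] at e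
  rw [e]
  rw [← lintegral_Ioo_rpow_neg_two_thirds hs]
  refine setLIntegral_congr_fun measurableSet_Ioo (fun x hx => ?_)
  rw [abs_of_pos hx.1]

/-- `∫⁻_{(0,s)} |x|^{-2/3} = 3·s^{1/3}`. [folklore] -/
theorem lintegral_Ioo_pos_abs_rpow {s : ℝ} (hs : 0 ≤ s) :
    ∫⁻ x in Ioo 0 s, ENNReal.ofReal (|x| ^ (-(2 / 3) : ℝ)) = ENNReal.ofReal (3 * s ^ (1 / 3 : ℝ)) := by
  rw [← lintegral_Ioo_rpow_neg_two_thirds hs]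
  refine setLIntegral_congr_fun measurableSet_Ioo (fun x hx => ?_)
  rw [abs_of_pos hx.1]

/-- `∫⁻_{(−s,0)∪(0,s)} |x|^{-2/3} ≤ 6·s^{1/3}`. [folklore] -/
theorem lintegral_puncturedIoo_abs_rpow_le {s : ℝ} (hs : 0 ≤ s) :
    ∫⁻ x in Ioo (-s) 0 ∪ Ioo 0 s, ENNReal.ofReal (|x| ^ (-(2 / 3) : ℝ)) ≤ ENNReal.ofReal (6 * s ^ (1 / 3 : ℝ)) := by
  refine (lintegral_union_le _ _ _).trans ?_
  rw [lintegral_Ioo_neg_abs_rpow hs, lintegral_Ioo_pos_abs_rpow hs, ← ENNReal.ofReal_add (by positivity) (by positivity)]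
  refine le_of_eq ?_; congr 1; ring

/-- The punctured symmetric interval is a.e. the full one. [folklore] -/
theorem puncturedIoo_ae_eq (s : ℝ) : (Ioo (-s) 0 ∪ Ioo 0 s : Set ℝ) =ᵐ[volume] Ioo (-s) s := by
  have h1 : (Ioo (-s) 0 ∪ Ioo 0 s : Set ℝ) ⊆ Ioo (-s) s := by
    rintro x (hx | hx) <;> constructor <;> linarith [hx.1, hx.2]
  have h2 : Ioo (-s) s \ (Ioo (-s) 0 ∪ Ioo 0 s) ⊆ ({0} : Set ℝ) := by
    intro x hx
    simp only [mem_sdiff, mem_Ioo, mem_union, not_or, not_and, not_lt, mem_singleton_iff] at hx ⊢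
    obtain ⟨⟨h1, h2⟩, h3, h4⟩ := hx
    have a := h3 h1
    by_contra hne
    rcases lt_or_gt_of_ne hne with h | h
    · linarith
    · linarith [h4 h]
  refine (ae_eq_set.2 ⟨?_, ?_⟩)
  · rw [sdiff_eq_empty.2 h1]; exact measure_empty
  · exact measure_mono_null h2 (Real.volume_singleton)

/-- ★★ **THE SYMMETRIC SLAB BOUND**: `∫⁻_{(−s,s)×(−A,A)×(−B,B)} (x²+y²+z²)⁻¹ ≤ 72·s^{1/3}A^{1/3}B^{1/3}` on `ℝ × ℝ × ℝ` (volume = the product measure) —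
the full-slab twin of LEAD's ✓`lintegral_octant_slab_inv_sum_sq_le`. [folklore] -/
theorem lintegral_symm_slab_inv_sum_sq_le {s A B : ℝ} (hs : 0 ≤ s) (hA : 0 ≤ A) (hB : 0 ≤ B) :
    ∫⁻ p in (Ioo (-s) s) ×ˢ ((Ioo (-A) A) ×ˢ (Ioo (-B) B)), ENNReal.ofReal ((p.1 ^ 2 + p.2.1 ^ 2 + p.2.2 ^ 2)⁻¹)
        ∂(volume : Measure (ℝ × ℝ × ℝ)) ≤
      ENNReal.ofReal (72 * s ^ (1 / 3 : ℝ) * A ^ (1 / 3 : ℝ) * B ^ (1 / 3 : ℝ)) := by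
  -- replace each interval by its punctured version (a.e. equal)
  have hae : ((Ioo (-s) 0 ∪ Ioo 0 s) ×ˢ ((Ioo (-A) 0 ∪ Ioo 0 A) ×ˢ (Ioo (-B) 0 ∪ Ioo 0 B)) : Set (ℝ × ℝ × ℝ)) =ᵐ[(volume : Measure (ℝ × ℝ × ℝ))]
      ((Ioo (-s) s) ×ˢ ((Ioo (-A) A) ×ˢ (Ioo (-B) B))) := by
    rw [Measure.volume_eq_prod, Measure.volume_eq_prod]
    exact Measure.set_prod_ae_eq (puncturedIoo_ae_eq s) (Measure.set_prod_ae_eq (puncturedIoo_ae_eq A) (puncturedIoo_ae_eq B))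
  rw [← setLIntegral_congr hae]
  -- pointwise AM–GM on the punctured slab
  have hpt : ∀ p ∈ ((Ioo (-s) 0 ∪ Ioo 0 s) ×ˢ ((Ioo (-A) 0 ∪ Ioo 0 A) ×ˢ (Ioo (-B) 0 ∪ Ioo 0 B)) : Set (ℝ × ℝ × ℝ)),
      ENNReal.ofReal ((p.1 ^ 2 + p.2.1 ^ 2 + p.2.2 ^ 2)⁻¹) ≤
        ENNReal.ofReal ((1 / 3 : ℝ) * |p.1| ^ (-(2 / 3) : ℝ)) * (ENNReal.ofReal (|p.2.1| ^ (-(2 / 3) : ℝ)) * ENNReal.ofReal (|p.2.2| ^ (-(2 / 3) : ℝ))) := by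
    rintro ⟨x, y, z⟩ ⟨hx, hy, hz⟩
    have hx0 : x ≠ 0 := by rcases hx with h | h <;> [exact h.2.ne; exact h.1.ne']
    have hy0 : y ≠ 0 := by rcases hy with h | h <;> [exact h.2.ne; exact h.1.ne']
    have hz0 : z ≠ 0 := by rcases hz with h | h <;> [exact h.2.ne; exact h.1.ne']
    have h := inv_sum_sq_three_le hx0 hy0 hz0
    rw [← ENNReal.ofReal_mul (Real.rpow_nonneg (abs_nonneg _) _), ← ENNReal.ofReal_mul (mul_nonneg (by norm_num) (Real.rpow_nonneg (abs_nonneg _) _))]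
    refine ENNReal.ofReal_le_ofReal ?_
    calc (x ^ 2 + y ^ 2 + z ^ 2)⁻¹ ≤ (1 / 3 : ℝ) * (|x| ^ (-(2 / 3) : ℝ) * |y| ^ (-(2 / 3) : ℝ) * |z| ^ (-(2 / 3) : ℝ)) := h
      _ = (1 / 3 : ℝ) * |x| ^ (-(2 / 3) : ℝ) * (|y| ^ (-(2 / 3) : ℝ) * |z| ^ (-(2 / 3) : ℝ)) := by ring
  have hmeas : MeasurableSet (((Ioo (-s) 0 ∪ Ioo 0 s) ×ˢ ((Ioo (-A) 0 ∪ Ioo 0 A) ×ˢ (Ioo (-B) 0 ∪ Ioo 0 B))) : Set (ℝ × ℝ × ℝ)) :=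
    (measurableSet_Ioo.union measurableSet_Ioo).prod ((measurableSet_Ioo.union measurableSet_Ioo).prod (measurableSet_Ioo.union measurableSet_Ioo))
  calc ∫⁻ p in ((Ioo (-s) 0 ∪ Ioo 0 s) ×ˢ ((Ioo (-A) 0 ∪ Ioo 0 A) ×ˢ (Ioo (-B) 0 ∪ Ioo 0 B))), ENNReal.ofReal ((p.1 ^ 2 + p.2.1 ^ 2 + p.2.2 ^ 2)⁻¹)
        ∂(volume : Measure (ℝ × ℝ × ℝ))
      ≤ ∫⁻ p in ((Ioo (-s) 0 ∪ Ioo 0 s) ×ˢ ((Ioo (-A) 0 ∪ Ioo 0 A) ×ˢ (Ioo (-B) 0 ∪ Ioo 0 B))),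
          ENNReal.ofReal ((1 / 3 : ℝ) * |p.1| ^ (-(2 / 3) : ℝ)) * (ENNReal.ofReal (|p.2.1| ^ (-(2 / 3) : ℝ)) * ENNReal.ofReal (|p.2.2| ^ (-(2 / 3) : ℝ)))
          ∂(volume : Measure (ℝ × ℝ × ℝ)) := setLIntegral_mono' hmeas hpt
    _ = (∫⁻ x in (Ioo (-s) 0 ∪ Ioo 0 s), ENNReal.ofReal ((1 / 3 : ℝ) * |x| ^ (-(2 / 3) : ℝ))) *
          ((∫⁻ y in (Ioo (-A) 0 ∪ Ioo 0 A), ENNReal.ofReal (|y| ^ (-(2 / 3) : ℝ))) * ∫⁻ z in (Ioo (-B) 0 ∪ Ioo 0 B), ENNReal.ofReal (|z| ^ (-(2 / 3) : ℝ))) := by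
        rw [Measure.volume_eq_prod, Measure.volume_eq_prod, ← Measure.prod_restrict, ← Measure.prod_restrict]
        have h2 : ∫⁻ q : ℝ × ℝ, ENNReal.ofReal (|q.1| ^ (-(2 / 3) : ℝ)) * ENNReal.ofReal (|q.2| ^ (-(2 / 3) : ℝ))
            ∂((volume.restrict (Ioo (-A) 0 ∪ Ioo 0 A)).prod (volume.restrict (Ioo (-B) 0 ∪ Ioo 0 B))) =
            (∫⁻ y in (Ioo (-A) 0 ∪ Ioo 0 A), ENNReal.ofReal (|y| ^ (-(2 / 3) : ℝ))) * ∫⁻ z in (Ioo (-B) 0 ∪ Ioo 0 B), ENNReal.ofReal (|z| ^ (-(2 / 3) : ℝ)) :=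
          lintegral_prod_mul (f := fun y : ℝ => ENNReal.ofReal (|y| ^ (-(2 / 3) : ℝ))) (g := fun z : ℝ => ENNReal.ofReal (|z| ^ (-(2 / 3) : ℝ)))
            (by fun_prop) (by fun_prop)
        have h1 := lintegral_prod_mul (μ := volume.restrict (Ioo (-s) 0 ∪ Ioo 0 s))
          (ν := (volume.restrict (Ioo (-A) 0 ∪ Ioo 0 A)).prod (volume.restrict (Ioo (-B) 0 ∪ Ioo 0 B)))
          (f := fun x : ℝ => ENNReal.ofReal ((1 / 3 : ℝ) * |x| ^ (-(2 / 3) : ℝ)))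
          (g := fun q : ℝ × ℝ => ENNReal.ofReal (|q.1| ^ (-(2 / 3) : ℝ)) * ENNReal.ofReal (|q.2| ^ (-(2 / 3) : ℝ))) (by fun_prop) (by fun_prop)
        rw [h2] at h1
        exact h1
    _ ≤ ENNReal.ofReal (2 * s ^ (1 / 3 : ℝ)) * (ENNReal.ofReal (6 * A ^ (1 / 3 : ℝ)) * ENNReal.ofReal (6 * B ^ (1 / 3 : ℝ))) := by
        have h1 : ∫⁻ x in (Ioo (-s) 0 ∪ Ioo 0 s), ENNReal.ofReal ((1 / 3 : ℝ) * |x| ^ (-(2 / 3) : ℝ)) ≤ ENNReal.ofReal (2 * s ^ (1 / 3 : ℝ)) := by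
          have e : ∀ x : ℝ, ENNReal.ofReal ((1 / 3 : ℝ) * |x| ^ (-(2 / 3) : ℝ)) = ENNReal.ofReal (1 / 3 : ℝ) * ENNReal.ofReal (|x| ^ (-(2 / 3) : ℝ)) :=
            fun x => ENNReal.ofReal_mul (by norm_num)
          simp_rw [e]
          rw [lintegral_const_mul _ (by fun_prop)]
          calc ENNReal.ofReal (1 / 3 : ℝ) * ∫⁻ x in (Ioo (-s) 0 ∪ Ioo 0 s), ENNReal.ofReal (|x| ^ (-(2 / 3) : ℝ))
              ≤ ENNReal.ofReal (1 / 3 : ℝ) * ENNReal.ofReal (6 * s ^ (1 / 3 : ℝ)) := mul_le_mul_right (lintegral_puncturedIoo_abs_rpow_le hs) _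
            _ = ENNReal.ofReal (2 * s ^ (1 / 3 : ℝ)) := by rw [← ENNReal.ofReal_mul (by norm_num)]; congr 1; ring
        exact mul_le_mul' h1 (mul_le_mul' (lintegral_puncturedIoo_abs_rpow_le hA) (lintegral_puncturedIoo_abs_rpow_le hB))
    _ = ENNReal.ofReal (72 * s ^ (1 / 3 : ℝ) * A ^ (1 / 3 : ℝ) * B ^ (1 / 3 : ℝ)) := by
        rw [← ENNReal.ofReal_mul (by positivity), ← ENNReal.ofReal_mul (by positivity)]
        congr 1; ring

end Summit.QuantumFields.YangMills.Theorems.SwapVirialDeficit.SigmaBall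

end
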